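import Summits.QuantumFields.YangMills.Theorems.UnitScaleTiltProp7NSIntertwinerOfRecord
import Summits.QuantumFields.YangMills.Theorems.UnitScaleTiltProp7QprimeCombL2Flat
import HarnessLib

/-!
# Route `UnitScaleTilt`, crux K1 «MinimiserStabilityRegPr» (stmt-QuantumFields-19200), EX positivity block ∕ LIFT-THREAD 2 — **ON THE LIFT LOCUS THE INTRINSIC GAUGE PROJECTOR
# OF RECORD IS PRINT'S (3.21) PROJECTOR: `hLift(U₀) ⟹ R_S(U₀) = projR (Δ^η_{U₀}) Q″`**, `Q″` = the top nested covariant mean of the averaging of record (✓`Prop7NSIntertwinerOfRecord`),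
# i.e. [Balaban1985BackgroundPropagators] p.394 «`R` = the orthogonal projection onto `Δ^η_U N(Q′)`, `N(Q′) = {λ : Q′λ = 0}`» with `Q′ := Q″`

Cell `ym3-torus` (HUMAN RULING D-0037; rung R3 — NOT d = 4, NOT infinite volume, NOT a mass gap, NOT Clay).  Width seat `ym3-torus-px13` (gen 9).  THEOREMS ONLY (0 `def`, 0 `sorry`);
`--supports stmt-QuantumFields-19200 --as helper`; count-neutral.  Nothing of [B9] §3, N06, `hThm2S`, EX or the crux is asserted.

THE POINT.  The residual algebra of record is `N_S(U₀) = ker(Q(U₀)∘D_{U₀}) = {λ : Q″λ is Ū₀-parallel}` (✓p734255 + ✓p734803 (iii)), print's is `N(Q′) = ker Q″`; `R_S` projects onto `Δ N_S`,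
print's `R` onto `Δ ker Q″`.  Always `Δ ker Q″ ≤ Δ N_S` (✓p734803 (v)).  Conversely, under ★px20's lifting hypothesis `hLift(U₀)` (every `Ū₀`-parallel coarse section is the restriction of
a `U₀♭`-parallel fine section — the `Lift L i U₀` antecedent of record of LIFT-THREAD 2, a THEOREM over irreducible data at fibre points, ✓`Prop7IrrLiftRowOfRecord.hIrrLift_of_record`),
✓`Prop7NestedMeanParallelLift.hHZ_of_parallelLift` replaces every `λ ∈ N_S` by `λ₁` with VANISHING top mean and the same `D_{U₀}`-image; so `Δλ = D*Dλ = D*Dλ₁ = Δλ₁ ∈ Δ ker Q″`.  Hence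
`Δ N_S = Δ ker Q″` and, by ✓`Prop7QprimeCombL2.projR_eq_of_map_ker_eq`, `R_S(U₀) = projR (covLapSite U₀) Q″`.  READING: the (C2′) «finite-rank correction of `R_S` relative to print» of
✓`Prop7SectET3DeltaPiT3PInv` VANISHES on the Lift locus; off it (px10's stratum (c): `U₀` irreducible, `Ū₀` reducible) it is the projector onto `Δ`(near-parallel preimages of the
non-liftable parallel coarse sections) — the directions behind px12 g11's ‼ on `hPcol`.  Consequence for LIFT-THREAD 2: under the inserted antecedent every `R_S`-carrying row IS the print
row with print's projector shape; for N06 suppliers: a row proved at `projR (covLapSite U₀) Q″` transfers to `R_S` by `rw` on the Lift locus (equality), beyond ✓p733476's monotonicity.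

WHAT IS PROVED (ns `…Theorems.Prop7RSEqPrintProjectorOfLift`; member `F`, `h : n ≤ K`, weights `c₀ > 0`, `cB`, `U₀ ∈ RegPr F n K ε₀`, `10¹²L³ε₀ ≤ 1`; `Q″` ANY linear map with
✓p734803's exported (iii) `htop` and (v) `hker`):
* ★★ `map_NS_le_map_ker_of_lift` ∕ ★★ `map_NS_eq_map_ker_of_lift` — `hLift ⟹ (N_S U₀).map (covLapSite U₀) = (ker Q″).map (covLapSite U₀)`;
* ★★★ `RS_eq_projR_of_lift` — `hLift ⟹ RS F n K h c₀ cB U₀ = projR (covLapSite F n K c₀ U₀) Q″`;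
* ★★ `exists_RS_eq_projR_of_lift` — packaged with ✓p734803: `hLift ⟹ ∃ Q″ D′, (∀ l, QL2 (DL2 l) = D′ (Q″ l)) ∧ RS U₀ = projR (covLapSite U₀) Q″`.
HONEST SCOPE.  Linear algebra over landed letters; no estimate; `hLift` is DISPLAYED (discharged elsewhere on irreducible fibres); nothing of the stub∕crux.  Rung R3, not Clay; YM gap NOT proved.

References: T. Bałaban, CMP **99** (1985) 389–434 [Balaban1985BackgroundPropagators] ((3.19)–(3.23) pp.393–394, (3.114)–(3.115) p.418); CMP **98** (1985) 17–51 [Balaban1985Averaging]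
((97) p.32).
-/

set_option autoImplicit false

noncomputable section

open scoped BigOperators Matrix.Norms.L2Operator

namespace Summit.QuantumFields.YangMills.Theorems.Prop7RSEqPrintProjectorOfLift

open NormedSpace
open Literature.MathematicalPhysics.QuantumFieldTheory.Balaban1983to89
open Literature.MathematicalPhysics.QuantumFieldTheory.Balaban1983to89.T3ContinuumYM3Torus
open T4Continuum BlockAveraging
open BlockAveraging (Idx)
open B7Prop1Explicit (disp)
open B7Eq78Linearization (conjR conjR_apply)
open B10Eq27TorusAxialLog (holT transl)
open B7TransferAnalyticMean (meanCLM)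
open B9Eq311L2Pairing (WL2)
open B11Eq103H1Complex (SiteL2K projR)
open B15DeterminingSets (embIter)
open Summit.QuantumFields.YangMills.Theorems.Prop8Chart (emlIterU)
open T3PrintedRegularMinimiser (RegPr)
open T3PrintedRegularOrbits (sites_eq)
open T3LevelShift (bondShift)
open T3SectALandauChart (bgUnits eta)
open Summit.QuantumFields.YangMills.Theorems.Prop7SectET3Transport (periodsT3)
open Summit.QuantumFields.YangMills.Theorems.Prop7SectET3HilbertLetters (W₂ toL2 toL2S toL2B QL2 DL2 DstarL2 covLapSite)
open Summit.QuantumFields.YangMills.Theorems.Prop7SectET3GaugeProjector (QDS NS RS mem_NS_iff RS_eq_projR)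
open Summit.QuantumFields.YangMills.Theorems.Prop7NestedMeanParallelLift (hHZ_of_parallelLift)
open Summit.QuantumFields.YangMills.Theorems.Prop7NSIntertwinerOfRecord (exists_intertwiner_of_regPr)
open Summit.QuantumFields.YangMills.Theorems.Prop7QprimeCombL2 (projR_eq_of_map_ker_eq)

variable (F : T3Family) {n K : ℕ}

/-- ★★ **UNDER THE LIFTING HYPOTHESIS, `Δ N_S(U₀) ≤ Δ ker Q″`**: for `toL2S λ ∈ N_S(U₀)`, ★px20's `hHZ_of_parallelLift` gives `λ₁` with vanishing top mean — hence `Q″(toL2S λ₁) = 0` by the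
top-mean property (iii) of `Q″` — and the same `D_{U₀}`-image, so `Δλ = D*Dλ₁ ∈ Δ(ker Q″)`. [cite: Balaban1985BackgroundPropagators, (3.19)-(3.23) pp.393-394, (3.115) p.418] -/
theorem map_NS_le_map_ker_of_lift (h : n ≤ K) {c₀ : ℝ} [Fact (0 < c₀)] (cB : ℝ) {ε₀ : ℝ} (hε₀ : 0 < ε₀) (hWε : 10 ^ 12 * (F.L : ℝ) ^ 3 * ε₀ ≤ 1)
    (U₀ : GaugeField (F.P K) 0 (Matrix.specialUnitaryGroup (Fin 2) ℂ)) (hreg : RegPr F n K ε₀ U₀)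
    (hLift : ∀ cf : Site (F.P K) (K - n) → Matrix (Fin 2) (Fin 2) ℂ,
      (∀ e : PBond (F.P K) (K - n), cf e.src = ((emlIterU (K - n) (bgUnits F K U₀) e : (Matrix (Fin 2) (Fin 2) ℂ)ˣ) : Matrix (Fin 2) (Fin 2) ℂ) * cf e.tgt *
        (((emlIterU (K - n) (bgUnits F K U₀) e)⁻¹ : (Matrix (Fin 2) (Fin 2) ℂ)ˣ) : Matrix (Fin 2) (Fin 2) ℂ)) →
      ∃ l₀ : Site (F.P K) 0 → Matrix (Fin 2) (Fin 2) ℂ,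
        (∀ b : PBond (F.P K) 0, l₀ b.src = ((bgUnits F K U₀ b : (Matrix (Fin 2) (Fin 2) ℂ)ˣ) : Matrix (Fin 2) (Fin 2) ℂ) * l₀ b.tgt * (((bgUnits F K U₀ b)⁻¹ : (Matrix (Fin 2) (Fin 2) ℂ)ˣ) : Matrix (Fin 2) (Fin 2) ℂ)) ∧
        ∀ y : Site (F.P K) (K - n), l₀ (embIter (K - n) y) = cf y)
    (Q'' : SiteL2K ℂ 3 (periodsT3 F K) c₀ W₂ →ₗ[ℂ] (Site (F.P K) (K - n) → Matrix (Fin 2) (Fin 2) ℂ))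
    (htop : ∀ (lam : Site (F.P K) 0 → Matrix (Fin 2) (Fin 2) ℂ) (ns : (j : ℕ) → Site (F.P K) j → Matrix (Fin 2) (Fin 2) ℂ), ns 0 = lam →
      (∀ (j : ℕ) (y : Site (F.P K) (j + 1)), ns (j + 1) y = ns j (emb y) - meanCLM (Idx (F.P K)) (Matrix (Fin 2) (Fin 2) ℂ) fun i : Idx (F.P K) =>
        ns j (emb y) - ((holT (emlIterU j (bgUnits F K U₀)) (emb y) (stairWord i.2.1 (off i.1)) : (Matrix (Fin 2) (Fin 2) ℂ)ˣ) : Matrix (Fin 2) (Fin 2) ℂ) *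
          ns j (transl (emb y) (disp (stairWord i.2.1 (off i.1)))) * (((holT (emlIterU j (bgUnits F K U₀)) (emb y) (stairWord i.2.1 (off i.1)))⁻¹ : (Matrix (Fin 2) (Fin 2) ℂ)ˣ) : Matrix (Fin 2) (Fin 2) ℂ)) →
      ns (K - n) = Q'' (toL2S F K c₀ lam)) :
    (NS F n K h c₀ cB U₀).map (covLapSite F n K c₀ U₀) ≤ (LinearMap.ker Q'').map (covLapSite F n K c₀ U₀) := by
  rintro w ⟨u, hu, rfl⟩
  rw [SetLike.mem_coe] at hu
  obtain ⟨lam, rfl⟩ : ∃ lam : Site (F.P K) 0 → Matrix (Fin 2) (Fin 2) ℂ, toL2S F K c₀ lam = u :=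
    ⟨(toL2S F K c₀).symm u, LinearEquiv.apply_symm_apply _ _⟩
  obtain ⟨l₁, _, ⟨ns, h0, hsucc, htop0⟩, hD⟩ := hHZ_of_parallelLift F h (c₀ := c₀) (cB := cB) hε₀ hWε U₀ hreg hLift lam hu
  refine ⟨toL2S F K c₀ l₁, ?_, ?_⟩
  · -- vanishing top mean ⇒ `Q″ = 0`
    rw [SetLike.mem_coe, LinearMap.mem_ker, ← htop l₁ ns h0 hsucc]
    funext y
    exact htop0 y
  · -- same `D_{U₀}`-image ⇒ same `Δ`-image
    show DstarL2 F n K c₀ U₀ (DL2 F n K c₀ U₀ (toL2S F K c₀ l₁)) = DstarL2 F n K c₀ U₀ (DL2 F n K c₀ U₀ (toL2S F K c₀ lam))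
    rw [hD]

/-- ★★ **UNDER THE LIFTING HYPOTHESIS, `Δ N_S(U₀) = Δ ker Q″`** (with `ker Q″ ≤ N_S(U₀)`, ✓`Prop7NSIntertwinerOfRecord` (v), for `⊇`).
[cite: Balaban1985BackgroundPropagators, (3.21)-(3.23) p.394, (3.115) p.418] -/
theorem map_NS_eq_map_ker_of_lift (h : n ≤ K) {c₀ : ℝ} [Fact (0 < c₀)] (cB : ℝ) {ε₀ : ℝ} (hε₀ : 0 < ε₀) (hWε : 10 ^ 12 * (F.L : ℝ) ^ 3 * ε₀ ≤ 1)
    (U₀ : GaugeField (F.P K) 0 (Matrix.specialUnitaryGroup (Fin 2) ℂ)) (hreg : RegPr F n K ε₀ U₀)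
    (hLift : ∀ cf : Site (F.P K) (K - n) → Matrix (Fin 2) (Fin 2) ℂ,
      (∀ e : PBond (F.P K) (K - n), cf e.src = ((emlIterU (K - n) (bgUnits F K U₀) e : (Matrix (Fin 2) (Fin 2) ℂ)ˣ) : Matrix (Fin 2) (Fin 2) ℂ) * cf e.tgt *
        (((emlIterU (K - n) (bgUnits F K U₀) e)⁻¹ : (Matrix (Fin 2) (Fin 2) ℂ)ˣ) : Matrix (Fin 2) (Fin 2) ℂ)) →
      ∃ l₀ : Site (F.P K) 0 → Matrix (Fin 2) (Fin 2) ℂ,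
        (∀ b : PBond (F.P K) 0, l₀ b.src = ((bgUnits F K U₀ b : (Matrix (Fin 2) (Fin 2) ℂ)ˣ) : Matrix (Fin 2) (Fin 2) ℂ) * l₀ b.tgt * (((bgUnits F K U₀ b)⁻¹ : (Matrix (Fin 2) (Fin 2) ℂ)ˣ) : Matrix (Fin 2) (Fin 2) ℂ)) ∧
        ∀ y : Site (F.P K) (K - n), l₀ (embIter (K - n) y) = cf y)
    (Q'' : SiteL2K ℂ 3 (periodsT3 F K) c₀ W₂ →ₗ[ℂ] (Site (F.P K) (K - n) → Matrix (Fin 2) (Fin 2) ℂ))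
    (htop : ∀ (lam : Site (F.P K) 0 → Matrix (Fin 2) (Fin 2) ℂ) (ns : (j : ℕ) → Site (F.P K) j → Matrix (Fin 2) (Fin 2) ℂ), ns 0 = lam →
      (∀ (j : ℕ) (y : Site (F.P K) (j + 1)), ns (j + 1) y = ns j (emb y) - meanCLM (Idx (F.P K)) (Matrix (Fin 2) (Fin 2) ℂ) fun i : Idx (F.P K) =>
        ns j (emb y) - ((holT (emlIterU j (bgUnits F K U₀)) (emb y) (stairWord i.2.1 (off i.1)) : (Matrix (Fin 2) (Fin 2) ℂ)ˣ) : Matrix (Fin 2) (Fin 2) ℂ) *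
          ns j (transl (emb y) (disp (stairWord i.2.1 (off i.1)))) * (((holT (emlIterU j (bgUnits F K U₀)) (emb y) (stairWord i.2.1 (off i.1)))⁻¹ : (Matrix (Fin 2) (Fin 2) ℂ)ˣ) : Matrix (Fin 2) (Fin 2) ℂ)) →
      ns (K - n) = Q'' (toL2S F K c₀ lam))
    (hker : LinearMap.ker Q'' ≤ NS F n K h c₀ cB U₀) :
    (NS F n K h c₀ cB U₀).map (covLapSite F n K c₀ U₀) = (LinearMap.ker Q'').map (covLapSite F n K c₀ U₀) :=
  le_antisymm (map_NS_le_map_ker_of_lift F h cB hε₀ hWε U₀ hreg hLift Q'' htop) (Submodule.map_mono hker)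

/-- ★★★ **ON THE LIFT LOCUS `R_S(U₀)` IS PRINT'S (3.21) PROJECTOR**: `hLift(U₀) ⟹ RS F n K h c₀ cB U₀ = projR (covLapSite F n K c₀ U₀) Q″` for every linear `Q″` with the top-mean property
(iii) and `ker Q″ ≤ N_S(U₀)` (v) of ✓`Prop7NSIntertwinerOfRecord.exists_intertwiner_of_regPr` — «`R` is the orthogonal projection onto `Δ^η_U N(Q′)`, `N(Q′) = {λ : Q′λ = 0}`» with
`Q′ := Q″`; the (C2′) finite-rank correction of the intrinsic projector vanishes there. [cite: Balaban1985BackgroundPropagators, (3.20)-(3.23) p.394, (3.115) p.418] -/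
theorem RS_eq_projR_of_lift (h : n ≤ K) {c₀ : ℝ} [Fact (0 < c₀)] (cB : ℝ) {ε₀ : ℝ} (hε₀ : 0 < ε₀) (hWε : 10 ^ 12 * (F.L : ℝ) ^ 3 * ε₀ ≤ 1)
    (U₀ : GaugeField (F.P K) 0 (Matrix.specialUnitaryGroup (Fin 2) ℂ)) (hreg : RegPr F n K ε₀ U₀)
    (hLift : ∀ cf : Site (F.P K) (K - n) → Matrix (Fin 2) (Fin 2) ℂ,
      (∀ e : PBond (F.P K) (K - n), cf e.src = ((emlIterU (K - n) (bgUnits F K U₀) e : (Matrix (Fin 2) (Fin 2) ℂ)ˣ) : Matrix (Fin 2) (Fin 2) ℂ) * cf e.tgt *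
        (((emlIterU (K - n) (bgUnits F K U₀) e)⁻¹ : (Matrix (Fin 2) (Fin 2) ℂ)ˣ) : Matrix (Fin 2) (Fin 2) ℂ)) →
      ∃ l₀ : Site (F.P K) 0 → Matrix (Fin 2) (Fin 2) ℂ,
        (∀ b : PBond (F.P K) 0, l₀ b.src = ((bgUnits F K U₀ b : (Matrix (Fin 2) (Fin 2) ℂ)ˣ) : Matrix (Fin 2) (Fin 2) ℂ) * l₀ b.tgt * (((bgUnits F K U₀ b)⁻¹ : (Matrix (Fin 2) (Fin 2) ℂ)ˣ) : Matrix (Fin 2) (Fin 2) ℂ)) ∧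
        ∀ y : Site (F.P K) (K - n), l₀ (embIter (K - n) y) = cf y)
    (Q'' : SiteL2K ℂ 3 (periodsT3 F K) c₀ W₂ →ₗ[ℂ] (Site (F.P K) (K - n) → Matrix (Fin 2) (Fin 2) ℂ))
    (htop : ∀ (lam : Site (F.P K) 0 → Matrix (Fin 2) (Fin 2) ℂ) (ns : (j : ℕ) → Site (F.P K) j → Matrix (Fin 2) (Fin 2) ℂ), ns 0 = lam →
      (∀ (j : ℕ) (y : Site (F.P K) (j + 1)), ns (j + 1) y = ns j (emb y) - meanCLM (Idx (F.P K)) (Matrix (Fin 2) (Fin 2) ℂ) fun i : Idx (F.P K) =>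
        ns j (emb y) - ((holT (emlIterU j (bgUnits F K U₀)) (emb y) (stairWord i.2.1 (off i.1)) : (Matrix (Fin 2) (Fin 2) ℂ)ˣ) : Matrix (Fin 2) (Fin 2) ℂ) *
          ns j (transl (emb y) (disp (stairWord i.2.1 (off i.1)))) * (((holT (emlIterU j (bgUnits F K U₀)) (emb y) (stairWord i.2.1 (off i.1)))⁻¹ : (Matrix (Fin 2) (Fin 2) ℂ)ˣ) : Matrix (Fin 2) (Fin 2) ℂ)) →
      ns (K - n) = Q'' (toL2S F K c₀ lam))
    (hker : LinearMap.ker Q'' ≤ NS F n K h c₀ cB U₀) :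
    RS F n K h c₀ cB U₀ = projR (covLapSite F n K c₀ U₀) Q'' := by
  rw [RS_eq_projR]
  exact projR_eq_of_map_ker_eq (covLapSite F n K c₀ U₀) (QDS F n K h c₀ cB U₀) Q'' (map_NS_eq_map_ker_of_lift F h cB hε₀ hWε U₀ hreg hLift Q'' htop hker)

/-- ★★ **PACKAGED WITH THE INTERTWINER**: `hLift(U₀) ⟹ ∃ Q″ D′` linear with the intertwining `QL2 U₀ (DL2 U₀ l) = D′ (Q″ l)` ([B9] (3.114)–(3.115)) AND `R_S(U₀) = projR (covLapSite U₀) Q″`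
(print's (3.21) shape) — the `(Q″, D′)` of ✓`exists_intertwiner_of_regPr`. [cite: Balaban1985BackgroundPropagators, (3.114)-(3.115) p.418, (3.20)-(3.23) p.394] -/
theorem exists_RS_eq_projR_of_lift (h : n ≤ K) {c₀ : ℝ} [Fact (0 < c₀)] (cB : ℝ) {ε₀ : ℝ} (hε₀ : 0 < ε₀) (hWε : 10 ^ 12 * (F.L : ℝ) ^ 3 * ε₀ ≤ 1)
    (U₀ : GaugeField (F.P K) 0 (Matrix.specialUnitaryGroup (Fin 2) ℂ)) (hreg : RegPr F n K ε₀ U₀)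
    (hLift : ∀ cf : Site (F.P K) (K - n) → Matrix (Fin 2) (Fin 2) ℂ,
      (∀ e : PBond (F.P K) (K - n), cf e.src = ((emlIterU (K - n) (bgUnits F K U₀) e : (Matrix (Fin 2) (Fin 2) ℂ)ˣ) : Matrix (Fin 2) (Fin 2) ℂ) * cf e.tgt *
        (((emlIterU (K - n) (bgUnits F K U₀) e)⁻¹ : (Matrix (Fin 2) (Fin 2) ℂ)ˣ) : Matrix (Fin 2) (Fin 2) ℂ)) →
      ∃ l₀ : Site (F.P K) 0 → Matrix (Fin 2) (Fin 2) ℂ,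
        (∀ b : PBond (F.P K) 0, l₀ b.src = ((bgUnits F K U₀ b : (Matrix (Fin 2) (Fin 2) ℂ)ˣ) : Matrix (Fin 2) (Fin 2) ℂ) * l₀ b.tgt * (((bgUnits F K U₀ b)⁻¹ : (Matrix (Fin 2) (Fin 2) ℂ)ˣ) : Matrix (Fin 2) (Fin 2) ℂ)) ∧
        ∀ y : Site (F.P K) (K - n), l₀ (embIter (K - n) y) = cf y) :
    ∃ (Q'' : SiteL2K ℂ 3 (periodsT3 F K) c₀ W₂ →ₗ[ℂ] (Site (F.P K) (K - n) → Matrix (Fin 2) (Fin 2) ℂ))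
      (D' : (Site (F.P K) (K - n) → Matrix (Fin 2) (Fin 2) ℂ) →ₗ[ℂ] WL2 ℂ (fun _ : PBond (F.P n) 0 => cB) W₂),
      (∀ l, QL2 F n K h c₀ cB U₀ (DL2 F n K c₀ U₀ l) = D' (Q'' l)) ∧
      RS F n K h c₀ cB U₀ = projR (covLapSite F n K c₀ U₀) Q'' := by
  obtain ⟨Q'', D', hint, _, htop, _, hker⟩ := exists_intertwiner_of_regPr F h (c₀ := c₀) cB hε₀ hWε U₀ hreg
  exact ⟨Q'', D', hint, RS_eq_projR_of_lift F h cB hε₀ hWε U₀ hreg hLift Q'' htop hker⟩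

end Summit.QuantumFields.YangMills.Theorems.Prop7RSEqPrintProjectorOfLift

end
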